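import Mathlib
import Summits.KontsevichZagierPeriods.Zeta5Search.HarmonicWolstenholme
import HarnessLib

/-!
# ζ(5) search — the prime-to-`p` harmonic sums to THIRD order (tools for the fourth digit (V4))

Cell `pub-zeta5` (HONEST FRAMING: systematic search; no irrationality claim unless certified), gen-2 seat generation 14
(REPORT-gen2-g14 §1, lemmas (N1)–(N3)).  With `ℓ := ⌊s/p⌋`, `u := s mod p`, and `N_{s,i} := H⁽ⁱ⁾_s − p^{−i}H⁽ⁱ⁾_ℓ` the prime-to-`p` part of the
harmonic sum (`harm i s − harm i (s/p)/p^i`), for a prime `p ≥ 5`: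
* `padicNorm_harmN3_sub_le` — **`N_{s,3} ≡ H⁽³⁾_u (mod p)`**;
* `padicNorm_harmN2_sub_le₂` — **`N_{s,2} ≡ H⁽²⁾_u − 2ℓp·H⁽³⁾_u + ℓ·H⁽²⁾_{p−1} (mod p²)`**;
* `padicNorm_harmN1_sub_le₃` — **`N_{s,1} ≡ H_u − ℓp·H⁽²⁾_u + ℓ²p²·H⁽³⁾_u + ℓ·H_{p−1} − p·(ℓ(ℓ−1)/2)·H⁽²⁾_{p−1} (mod p³)`**
(induction on `s`: inside a block the one-term expansions `1/(u+t)³ ≡ 1/u³ (mod p)`, `1/(u+t)² ≡ 1/u² − 2t/u³ (mod p²)`,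
`1/(u+t) ≡ 1/u − t/u² + t²/u³ (mod p³)` for a unit `u` and `‖t‖ ≤ p⁻¹`; a completed block changes the right-hand sides by a multiple of
`p·H⁽³⁾_{p−1}` resp. `p²·H⁽³⁾_{p−1}`, and `H⁽³⁾_{p−1} ≡ 0 (mod p)` — `padicNorm_harm3_pred_le'` below, proved here again to keep this file
independent of the cubic-Wolstenholme file).  One order beyond `padicNorm_harmN2_sub_le` / `padicNorm_harmN1_sub_le₂`.
`p`-adic norms of rational numbers; nothing here concerns irrationality.
-/

noncomputable section

open Finset

namespace Summit.KontsevichZagierPeriods.Zeta5Search.SecondOrder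

open Summit.KontsevichZagierPeriods.Zeta5Search.PadicSeries
open Summit.KontsevichZagierPeriods.Zeta5Search.ClusterValuation (PInt.intCast PInt.zpow_int PInt.cast_zpow_int PInt.sum PInt.cast_sum
  PInt.pCong_of_cast_eq_zero pCong padicNorm_le_of_val)
open Summit.KontsevichZagierPeriods.Zeta5Search.CellA (padicNorm_p padicNorm_inv_sub_inv_le harm_succ padicNorm_harm_le_one padicNorm_pow_eq)
open Summit.KontsevichZagierPeriods.Zeta5Search.ResidueLaw (sum_range_erase_eq_sum_univ_erase)
open Literature.NumberTheory.Transcendental.BallRivoal (harm)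

variable {p : ℕ} [hp : Fact p.Prime]

/-! ### `H^{(3)}_{p−1} ≡ 0 (mod p)` -/

/-- **`H^{(3)}_{p−1} ≡ 0 (mod p)`** for a prime `p ≥ 5` (in `ZMod p`: `Σ_{a≠0} a⁻³ = Σ_a a^{p−4} = 0`). -/
theorem padicNorm_harm3_pred_le' (hp5 : 5 ≤ p) : padicNorm p (harm 3 (p - 1)) ≤ (p : ℚ) ^ (-(1 : ℤ)) := by
  have hp1 := hp.out.one_lt
  have hcard : Fintype.card (ZMod p) = p := ZMod.card p
  have hZ : ∑ a ∈ (univ : Finset (ZMod p)).erase 0, a ^ (-(3 : ℤ)) = 0 := by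
    have hconv : ∀ a ∈ (univ : Finset (ZMod p)).erase 0, a ^ (-(3 : ℤ)) = a ^ (p - 4) := by
      intro a ha
      have ha0 : a ≠ 0 := (mem_erase.1 ha).1
      have hF : a ^ (p - 1) = 1 := ZMod.pow_card_sub_one_eq_one ha0
      have e : a ^ (p - 4) * a ^ 3 = 1 := by rw [← pow_add, show p - 4 + 3 = p - 1 by omega, hF]
      rw [show (-(3 : ℤ)) = -((3 : ℕ) : ℤ) by norm_num, zpow_neg, zpow_natCast]
      exact (eq_inv_of_mul_eq_one_left e).symm
    rw [sum_congr rfl hconv, sum_erase_eq_sub (mem_univ _), zero_pow (by omega), sub_zero]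
    exact FiniteField.sum_pow_lt_card_sub_one (K := ZMod p) (p - 4) (by rw [hcard]; omega)
  have hterm : ∀ m : ℕ, (1 : ℚ) / ((m : ℚ) + 1) ^ 3 = (((m + 1 : ℕ) : ℤ) : ℚ) ^ (-(3 : ℤ)) := by
    intro m
    rw [show (-(3 : ℤ)) = -((3 : ℕ) : ℤ) by norm_num, zpow_neg, zpow_natCast, one_div]
    push_cast; ring
  have hunit : ∀ m ∈ range (p - 1), ¬ (p : ℤ) ∣ ((m + 1 : ℕ) : ℤ) := by
    intro m hm h
    have hm' := mem_range.1 hm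
    have := Int.le_of_dvd (by push_cast; omega) h
    push_cast at this; omega
  have hden : ∀ m ∈ range (p - 1), ¬ p ∣ ((1 : ℚ) / ((m : ℚ) + 1) ^ 3).den := by
    intro m hm; rw [hterm m]; exact PInt.zpow_int (hunit m hm) _
  have hdenS : ¬ p ∣ (harm 3 (p - 1)).den := by rw [harm]; exact PInt.sum hden
  have hcast : ((harm 3 (p - 1) : ℚ) : ZMod p) = 0 := by
    rw [harm, PInt.cast_sum hden]
    have h1 : ∀ m ∈ range (p - 1), (((1 : ℚ) / ((m : ℚ) + 1) ^ 3 : ℚ) : ZMod p) = (((m + 1 : ℕ) : ℕ) : ZMod p) ^ (-(3 : ℤ)) := by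
      intro m hm
      rw [hterm m, PInt.cast_zpow_int (hunit m hm), Int.cast_natCast]
    rw [sum_congr rfl h1]
    have h2 : ∑ m ∈ range (p - 1), (((m + 1 : ℕ) : ℕ) : ZMod p) ^ (-(3 : ℤ)) =
        ∑ y ∈ (range p).erase 0, ((y : ℕ) : ZMod p) ^ (-(3 : ℤ)) := by
      have h3 : (range p).erase 0 = Ico 1 p := by
        ext y; simp only [Finset.mem_erase, Finset.mem_range, Finset.mem_Ico]; omega
      rw [h3, Finset.sum_Ico_eq_sum_range]
      refine sum_congr (by rw [show p - 1 = p - 1 from rfl]) fun m _ => by rw [add_comm]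
    rw [h2, sum_range_erase_eq_sum_univ_erase (fun z : ZMod p => z ^ (-(3 : ℤ))) hp.out.pos, Nat.cast_zero]
    exact hZ
  have h := PInt.pCong_of_cast_eq_zero hdenS hcast
  rw [pCong, decide_eq_true_iff] at h
  exact padicNorm_le_of_val fun hne => h.resolve_left hne

/-! ### One-term expansions to third order -/

/-- `‖e/(u+t)³ − e/u³‖ ≤ p⁻¹` for a unit `u` and `‖t‖ ≤ p⁻¹`. -/
theorem padicNorm_div_cube_sub_le {e u t : ℚ} (he : padicNorm p e ≤ 1) (hu : padicNorm p u = 1)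
    (ht : padicNorm p t ≤ (p : ℚ) ^ (-(1 : ℤ))) :
    padicNorm p (e / (u + t) ^ 3 - e / u ^ 3) ≤ (p : ℚ) ^ (-(1 : ℤ)) := by
  have hu0 : u ≠ 0 := fun h => by rw [h, padicNorm.zero] at hu; exact zero_ne_one hu
  have hut1 := padicNorm_add_small_eq_one hu ht
  have hut0 : u + t ≠ 0 := fun h => by rw [h, padicNorm.zero] at hut1; exact zero_ne_one hut1
  have ht1 : padicNorm p t ≤ 1 := ht.trans (zpow_le_one_of_nonpos₀ one_le_p (by norm_num))
  have e1 : e / (u + t) ^ 3 - e / u ^ 3 = -(e * (3 * u ^ 2 + 3 * u * t + t ^ 2) * t) / ((u + t) ^ 3 * u ^ 3) := by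
    field_simp; ring
  rw [e1, padicNorm.div, padicNorm.mul, padicNorm_pow_eq, padicNorm_pow_eq, hut1, hu, one_pow, mul_one, div_one,
    padicNorm.neg, padicNorm.mul, padicNorm.mul]
  have hpoly : padicNorm p (3 * u ^ 2 + 3 * u * t + t ^ 2) ≤ 1 := by
    have h3 : padicNorm p (3 : ℚ) ≤ 1 := by simpa using padicNorm.of_nat (p := p) 3
    refine (padicNorm.nonarchimedean (p := p)).trans (max_le ((padicNorm.nonarchimedean (p := p)).trans (max_le ?_ ?_)) ?_)
    · rw [padicNorm.mul, padicNorm_pow_eq, hu, one_pow, mul_one]; exact h3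
    · rw [padicNorm.mul, padicNorm.mul, hu, mul_one]
      calc padicNorm p 3 * padicNorm p t ≤ 1 * 1 := mul_le_mul h3 ht1 (padicNorm.nonneg _) zero_le_one
        _ = 1 := one_mul 1
    · rw [padicNorm_pow_eq]
      calc padicNorm p t ^ 2 ≤ 1 ^ 2 := pow_le_pow_left₀ (padicNorm.nonneg _) ht1 2
        _ = 1 := one_pow 2
  calc padicNorm p e * padicNorm p (3 * u ^ 2 + 3 * u * t + t ^ 2) * padicNorm p t ≤ 1 * 1 * (p : ℚ) ^ (-(1 : ℤ)) :=
        mul_le_mul (mul_le_mul he hpoly (padicNorm.nonneg _) zero_le_one) ht (padicNorm.nonneg _) (by positivity)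
    _ = _ := by ring

/-- `‖e/(u+t)² − (e/u² − 2t·e/u³)‖ ≤ p⁻²` for a unit `u` and `‖t‖ ≤ p⁻¹`. -/
theorem padicNorm_div_sq_add_sub_le {e u t : ℚ} (he : padicNorm p e ≤ 1) (hu : padicNorm p u = 1)
    (ht : padicNorm p t ≤ (p : ℚ) ^ (-(1 : ℤ))) :
    padicNorm p (e / (u + t) ^ 2 - (e / u ^ 2 - 2 * t * (e / u ^ 3))) ≤ (p : ℚ) ^ (-(2 : ℤ)) := by
  have hu0 : u ≠ 0 := fun h => by rw [h, padicNorm.zero] at hu; exact zero_ne_one hu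
  have hut1 := padicNorm_add_small_eq_one hu ht
  have hut0 : u + t ≠ 0 := fun h => by rw [h, padicNorm.zero] at hut1; exact zero_ne_one hut1
  have ht1 : padicNorm p t ≤ 1 := ht.trans (zpow_le_one_of_nonpos₀ one_le_p (by norm_num))
  have e1 : e / (u + t) ^ 2 - (e / u ^ 2 - 2 * t * (e / u ^ 3)) = e * (3 * u + 2 * t) * t ^ 2 / (u ^ 3 * (u + t) ^ 2) := by
    field_simp; ring
  rw [e1, padicNorm.div, padicNorm.mul, padicNorm.mul, padicNorm.mul, padicNorm_pow_eq u 3, padicNorm_pow_eq (u + t) 2, hu, hut1,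
    one_pow, one_pow, mul_one, div_one]
  have hpoly : padicNorm p (3 * u + 2 * t) ≤ 1 := by
    refine (padicNorm.nonarchimedean (p := p)).trans (max_le ?_ ?_)
    · rw [padicNorm.mul, hu, mul_one]; simpa using padicNorm.of_nat (p := p) 3
    · rw [padicNorm.mul]
      calc padicNorm p 2 * padicNorm p t ≤ 1 * 1 :=
            mul_le_mul (by simpa using padicNorm.of_nat (p := p) 2) ht1 (padicNorm.nonneg _) zero_le_one
        _ = 1 := one_mul 1
  calc padicNorm p e * padicNorm p (3 * u + 2 * t) * padicNorm p (t ^ 2) ≤ 1 * 1 * (p : ℚ) ^ (-(2 : ℤ)) :=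
        mul_le_mul (mul_le_mul he hpoly (padicNorm.nonneg _) zero_le_one) (padicNorm_sq_le ht) (padicNorm.nonneg _)
          (by positivity)
    _ = _ := by ring

/-- `‖e/(u+t) − (e/u − t·e/u² + t²·e/u³)‖ ≤ p⁻³` for a unit `u` and `‖t‖ ≤ p⁻¹`. -/
theorem padicNorm_div_add_sub_le₃ {e u t : ℚ} (he : padicNorm p e ≤ 1) (hu : padicNorm p u = 1)
    (ht : padicNorm p t ≤ (p : ℚ) ^ (-(1 : ℤ))) :
    padicNorm p (e / (u + t) - (e / u - t * (e / u ^ 2) + t ^ 2 * (e / u ^ 3))) ≤ (p : ℚ) ^ (-(3 : ℤ)) := by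
  have hp0 : (p : ℚ) ≠ 0 := Nat.cast_ne_zero.2 hp.out.ne_zero
  have hu0 : u ≠ 0 := fun h => by rw [h, padicNorm.zero] at hu; exact zero_ne_one hu
  have hut1 := padicNorm_add_small_eq_one hu ht
  have hut0 : u + t ≠ 0 := fun h => by rw [h, padicNorm.zero] at hut1; exact zero_ne_one hut1
  have e1 : e / (u + t) - (e / u - t * (e / u ^ 2) + t ^ 2 * (e / u ^ 3)) = -(e * t ^ 3) / (u ^ 3 * (u + t)) := by
    field_simp; ring
  rw [e1, padicNorm.div, padicNorm.neg, padicNorm.mul, padicNorm.mul, padicNorm_pow_eq u 3, hu, hut1, one_pow, mul_one, div_one,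
    padicNorm_pow_eq]
  have ht3 : padicNorm p t ^ 3 ≤ ((p : ℚ) ^ (-(1 : ℤ))) ^ 3 := pow_le_pow_left₀ (padicNorm.nonneg _) ht 3
  calc padicNorm p e * padicNorm p t ^ 3 ≤ 1 * ((p : ℚ) ^ (-(1 : ℤ))) ^ 3 :=
        mul_le_mul he ht3 (pow_nonneg (padicNorm.nonneg _) 3) zero_le_one
    _ = (p : ℚ) ^ (-(3 : ℤ)) := by rw [one_mul, ← zpow_natCast, ← zpow_mul]; norm_num

/-! ### The prime-to-`p` harmonic sums to third order -/

/-- **`N_{s,3} ≡ H^{(3)}_{s mod p} (mod p)`** (`p ≥ 5`). -/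
theorem padicNorm_harmN3_sub_le (hp5 : 5 ≤ p) (s : ℕ) :
    padicNorm p (harm 3 s - harm 3 (s / p) / (p : ℚ) ^ 3 - harm 3 (s % p)) ≤ (p : ℚ) ^ (-(1 : ℤ)) := by
  have hp1 := hp.out.one_lt
  have hp0 : (p : ℚ) ≠ 0 := Nat.cast_ne_zero.2 hp.out.ne_zero
  have h00 : harm 3 0 = 0 := by simp [harm]
  induction s with
  | zero =>
    rw [Nat.zero_div, Nat.zero_mod, h00, zero_div, sub_zero, sub_zero, padicNorm.zero]; exact zpow_p_nonneg _
  | succ s ih =>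
    rw [Nat.succ_div, harm_succ]
    by_cases hdvd : p ∣ s + 1
    · obtain ⟨hsm, hs0⟩ := (succ_mod_cases (p := p) hp1).1 hdvd
      rw [if_pos hdvd, harm_succ, hs0, h00, sub_zero]
      obtain ⟨m, hm⟩ := hdvd
      obtain ⟨hm0, hdiv, hs1, hm1⟩ := div_of_dvd_succ (p := p) hm
      have e : harm 3 s + 1 / ((s : ℚ) + 1) ^ 3 - (harm 3 (s / p) + 1 / (((s / p : ℕ) : ℚ) + 1) ^ 3) / (p : ℚ) ^ 3 =
          (harm 3 s - harm 3 (s / p) / (p : ℚ) ^ 3 - harm 3 (s % p)) + harm 3 (p - 1) := by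
        have hmq : (m : ℚ) ≠ 0 := by exact_mod_cast hm0.ne'
        rw [hs1, hm1, hsm]
        field_simp
        ring
      rw [e]
      exact (padicNorm.nonarchimedean (p := p)).trans (max_le ih (padicNorm_harm3_pred_le' hp5))
    · have hs1 := (succ_mod_cases (p := p) hp1).2 hdvd
      rw [if_neg hdvd, add_zero, hs1, harm_succ]
      have e : harm 3 s + 1 / ((s : ℚ) + 1) ^ 3 - harm 3 (s / p) / (p : ℚ) ^ 3 -
          (harm 3 (s % p) + 1 / (((s % p : ℕ) : ℚ) + 1) ^ 3) =
          (harm 3 s - harm 3 (s / p) / (p : ℚ) ^ 3 - harm 3 (s % p)) +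
            (1 / (((((s % p : ℕ) : ℚ)) + 1) + (p : ℚ) * ((s / p : ℕ) : ℚ)) ^ 3 - 1 / ((((s % p : ℕ) : ℚ)) + 1) ^ 3) := by
        rw [(succ_eq_residue_add_level (p := p) s).1]; ring
      rw [e]
      refine (padicNorm.nonarchimedean (p := p)).trans (max_le ih ?_)
      exact padicNorm_div_cube_sub_le (by rw [padicNorm.one]) (padicNorm_residue_succ_eq_one hdvd)
        (succ_eq_residue_add_level (p := p) s).2

/-- **`N_{s,2} ≡ H^{(2)}_{s mod p} − 2⌊s/p⌋p·H^{(3)}_{s mod p} + ⌊s/p⌋·H^{(2)}_{p−1} (mod p²)`** (`p ≥ 5`). -/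
theorem padicNorm_harmN2_sub_le₂ (hp5 : 5 ≤ p) (s : ℕ) :
    padicNorm p (harm 2 s - harm 2 (s / p) / (p : ℚ) ^ 2
      - (harm 2 (s % p) - 2 * (((s / p : ℕ) : ℚ) * p) * harm 3 (s % p) + ((s / p : ℕ) : ℚ) * harm 2 (p - 1)))
      ≤ (p : ℚ) ^ (-(2 : ℤ)) := by
  have hp1 := hp.out.one_lt
  have hp0 : (p : ℚ) ≠ 0 := Nat.cast_ne_zero.2 hp.out.ne_zero
  have h002 : harm 2 0 = 0 := by simp [harm]
  have h003 : harm 3 0 = 0 := by simp [harm]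
  induction s with
  | zero =>
    rw [Nat.zero_div, Nat.zero_mod, h002, h003, zero_div, sub_zero, mul_zero, sub_zero, Nat.cast_zero, zero_mul, add_zero,
      sub_zero, padicNorm.zero]
    exact zpow_p_nonneg _
  | succ s ih =>
    rw [Nat.succ_div, harm_succ]
    by_cases hdvd : p ∣ s + 1
    · obtain ⟨hsm, hs0⟩ := (succ_mod_cases (p := p) hp1).1 hdvd
      rw [if_pos hdvd, harm_succ, hs0, h002, h003, mul_zero, sub_zero]
      obtain ⟨m, hm⟩ := hdvd
      obtain ⟨hm0, hdiv, hs1, hm1⟩ := div_of_dvd_succ (p := p) hm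
      have e : harm 2 s + 1 / ((s : ℚ) + 1) ^ 2 - (harm 2 (s / p) + 1 / (((s / p : ℕ) : ℚ) + 1) ^ 2) / (p : ℚ) ^ 2
          - (0 + (((s / p + 1 : ℕ)) : ℚ) * harm 2 (p - 1)) =
          (harm 2 s - harm 2 (s / p) / (p : ℚ) ^ 2
            - (harm 2 (s % p) - 2 * (((s / p : ℕ) : ℚ) * p) * harm 3 (s % p) + ((s / p : ℕ) : ℚ) * harm 2 (p - 1)))
            + (-(2 * (((s / p : ℕ) : ℚ) * p) * harm 3 (p - 1))) := by
        have hmq : (m : ℚ) ≠ 0 := by exact_mod_cast hm0.ne'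
        have hl1 : ((s / p : ℕ) : ℚ) = (m : ℚ) - 1 := by linarith [hm1]
        push_cast
        rw [hs1, hm1, hsm, hl1]
        field_simp
        ring
      rw [e]
      refine (padicNorm.nonarchimedean (p := p)).trans (max_le ih ?_)
      rw [padicNorm.neg, padicNorm.mul, padicNorm.mul, padicNorm.mul, padicNorm_p]
      have h2 : padicNorm p (2 : ℚ) ≤ 1 := by simpa using padicNorm.of_nat (p := p) 2
      have hl : padicNorm p ((s / p : ℕ) : ℚ) ≤ 1 := by simpa using padicNorm.of_nat (p := p) (s / p)
      calc padicNorm p 2 * (padicNorm p ((s / p : ℕ) : ℚ) * (p : ℚ) ^ (-(1 : ℤ))) * padicNorm p (harm 3 (p - 1))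
          ≤ 1 * (1 * (p : ℚ) ^ (-(1 : ℤ))) * (p : ℚ) ^ (-(1 : ℤ)) :=
            mul_le_mul (mul_le_mul h2 (mul_le_mul_of_nonneg_right hl (zpow_p_nonneg _))
              (mul_nonneg (padicNorm.nonneg _) (zpow_p_nonneg _)) zero_le_one)
              (padicNorm_harm3_pred_le' hp5) (padicNorm.nonneg _) (by positivity)
        _ = (p : ℚ) ^ (-(2 : ℤ)) := by rw [one_mul, one_mul, ← zpow_add₀ hp0]; norm_num
    · have hs1 := (succ_mod_cases (p := p) hp1).2 hdvd
      rw [if_neg hdvd, add_zero, hs1, harm_succ, harm_succ]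
      obtain ⟨hdec, ht⟩ := succ_eq_residue_add_level (p := p) s
      set u : ℚ := ((((s % p : ℕ) : ℚ)) + 1) with hu
      set t : ℚ := (p : ℚ) * ((s / p : ℕ) : ℚ) with htdef
      have e : harm 2 s + 1 / ((s : ℚ) + 1) ^ 2 - harm 2 (s / p) / (p : ℚ) ^ 2 -
          (harm 2 (s % p) + 1 / u ^ 2 - 2 * (((s / p : ℕ) : ℚ) * p) * (harm 3 (s % p) + 1 / u ^ 3)
            + ((s / p : ℕ) : ℚ) * harm 2 (p - 1)) =
          (harm 2 s - harm 2 (s / p) / (p : ℚ) ^ 2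
            - (harm 2 (s % p) - 2 * (((s / p : ℕ) : ℚ) * p) * harm 3 (s % p) + ((s / p : ℕ) : ℚ) * harm 2 (p - 1)))
            + (1 / (u + t) ^ 2 - (1 / u ^ 2 - 2 * t * (1 / u ^ 3))) := by
        rw [hdec, htdef]; ring
      rw [e]
      refine (padicNorm.nonarchimedean (p := p)).trans (max_le ih ?_)
      exact padicNorm_div_sq_add_sub_le (by rw [padicNorm.one]) (padicNorm_residue_succ_eq_one hdvd) ht

/-- **`N_{s,1} ≡ H_u − ℓp·H^{(2)}_u + ℓ²p²·H^{(3)}_u + ℓ·H_{p−1} − p·(ℓ(ℓ−1)/2)·H^{(2)}_{p−1} (mod p³)`** (`p ≥ 5`; `ℓ = ⌊s/p⌋`,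
`u = s mod p`).  No Wolstenholme is used here: the block terms are carried explicitly (they are evaluated mod `p³` by the cubic
Wolstenholme congruence where (V4) needs them). -/
theorem padicNorm_harmN1_sub_le₃ (hp5 : 5 ≤ p) (s : ℕ) :
    padicNorm p (harm 1 s - harm 1 (s / p) / (p : ℚ) ^ 1
      - (harm 1 (s % p) - (((s / p : ℕ) : ℚ) * p) * harm 2 (s % p) + (((s / p : ℕ) : ℚ) * p) ^ 2 * harm 3 (s % p)
          + ((s / p : ℕ) : ℚ) * harm 1 (p - 1) - (p : ℚ) * (((s / p : ℕ) : ℚ) * (((s / p : ℕ) : ℚ) - 1) / 2) * harm 2 (p - 1)))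
      ≤ (p : ℚ) ^ (-(3 : ℤ)) := by
  have hp1 := hp.out.one_lt
  have hp0 : (p : ℚ) ≠ 0 := Nat.cast_ne_zero.2 hp.out.ne_zero
  have h00 : harm 1 0 = 0 := by simp [harm]
  have h002 : harm 2 0 = 0 := by simp [harm]
  have h003 : harm 3 0 = 0 := by simp [harm]
  induction s with
  | zero =>
    have e : harm 1 0 - harm 1 (0 / p) / (p : ℚ) ^ 1
        - (harm 1 (0 % p) - (((0 / p : ℕ) : ℚ) * p) * harm 2 (0 % p) + (((0 / p : ℕ) : ℚ) * p) ^ 2 * harm 3 (0 % p)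
          + ((0 / p : ℕ) : ℚ) * harm 1 (p - 1) - (p : ℚ) * (((0 / p : ℕ) : ℚ) * (((0 / p : ℕ) : ℚ) - 1) / 2) * harm 2 (p - 1)) = 0 := by
      rw [Nat.zero_div, Nat.zero_mod, h00, h002, h003]; push_cast; ring
    rw [e, padicNorm.zero]; exact zpow_p_nonneg _
  | succ s ih =>
    rw [Nat.succ_div, harm_succ]
    by_cases hdvd : p ∣ s + 1
    · obtain ⟨hsm, hs0⟩ := (succ_mod_cases (p := p) hp1).1 hdvd
      rw [if_pos hdvd, harm_succ, hs0, h00, h002, h003, mul_zero, mul_zero, sub_zero, add_zero]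
      obtain ⟨m, hm⟩ := hdvd
      obtain ⟨hm0, hdiv, hs1, hm1⟩ := div_of_dvd_succ (p := p) hm
      have e : harm 1 s + 1 / ((s : ℚ) + 1) ^ 1 - (harm 1 (s / p) + 1 / (((s / p : ℕ) : ℚ) + 1) ^ 1) / (p : ℚ) ^ 1
          - (0 + (((s / p + 1 : ℕ)) : ℚ) * harm 1 (p - 1)
              - (p : ℚ) * ((((s / p + 1 : ℕ)) : ℚ) * ((((s / p + 1 : ℕ)) : ℚ) - 1) / 2) * harm 2 (p - 1)) =
          (harm 1 s - harm 1 (s / p) / (p : ℚ) ^ 1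
            - (harm 1 (s % p) - (((s / p : ℕ) : ℚ) * p) * harm 2 (s % p) + (((s / p : ℕ) : ℚ) * p) ^ 2 * harm 3 (s % p)
              + ((s / p : ℕ) : ℚ) * harm 1 (p - 1) - (p : ℚ) * (((s / p : ℕ) : ℚ) * (((s / p : ℕ) : ℚ) - 1) / 2) * harm 2 (p - 1)))
            + (((s / p : ℕ) : ℚ) * p) ^ 2 * harm 3 (p - 1) := by
        have hmq : (m : ℚ) ≠ 0 := by exact_mod_cast hm0.ne'
        have hl1 : ((s / p : ℕ) : ℚ) = (m : ℚ) - 1 := by linarith [hm1]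
        push_cast
        rw [hs1, hm1, hsm, hl1]
        field_simp
        ring
      rw [e]
      refine (padicNorm.nonarchimedean (p := p)).trans (max_le ih ?_)
      rw [padicNorm.mul, padicNorm_pow_eq, padicNorm.mul, padicNorm_p]
      have hl : padicNorm p ((s / p : ℕ) : ℚ) ≤ 1 := by simpa using padicNorm.of_nat (p := p) (s / p)
      calc (padicNorm p ((s / p : ℕ) : ℚ) * (p : ℚ) ^ (-(1 : ℤ))) ^ 2 * padicNorm p (harm 3 (p - 1))
          ≤ (1 * (p : ℚ) ^ (-(1 : ℤ))) ^ 2 * (p : ℚ) ^ (-(1 : ℤ)) :=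
            mul_le_mul (pow_le_pow_left₀ (mul_nonneg (padicNorm.nonneg _) (zpow_p_nonneg _))
              (mul_le_mul_of_nonneg_right hl (zpow_p_nonneg _)) 2)
              (padicNorm_harm3_pred_le' hp5) (padicNorm.nonneg _) (by positivity)
        _ = (p : ℚ) ^ (-(3 : ℤ)) := by rw [one_mul, ← zpow_natCast, ← zpow_mul, ← zpow_add₀ hp0]; norm_num
    · have hs1 := (succ_mod_cases (p := p) hp1).2 hdvd
      rw [if_neg hdvd, add_zero, hs1, harm_succ, harm_succ, harm_succ]
      obtain ⟨hdec, ht⟩ := succ_eq_residue_add_level (p := p) s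
      set u : ℚ := ((((s % p : ℕ) : ℚ)) + 1) with hu
      set t : ℚ := (p : ℚ) * ((s / p : ℕ) : ℚ) with htdef
      have e : harm 1 s + 1 / ((s : ℚ) + 1) ^ 1 - harm 1 (s / p) / (p : ℚ) ^ 1 -
          (harm 1 (s % p) + 1 / u ^ 1 - (((s / p : ℕ) : ℚ) * p) * (harm 2 (s % p) + 1 / u ^ 2)
            + (((s / p : ℕ) : ℚ) * p) ^ 2 * (harm 3 (s % p) + 1 / u ^ 3)
            + ((s / p : ℕ) : ℚ) * harm 1 (p - 1) - (p : ℚ) * (((s / p : ℕ) : ℚ) * (((s / p : ℕ) : ℚ) - 1) / 2) * harm 2 (p - 1)) =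
          (harm 1 s - harm 1 (s / p) / (p : ℚ) ^ 1
            - (harm 1 (s % p) - (((s / p : ℕ) : ℚ) * p) * harm 2 (s % p) + (((s / p : ℕ) : ℚ) * p) ^ 2 * harm 3 (s % p)
              + ((s / p : ℕ) : ℚ) * harm 1 (p - 1) - (p : ℚ) * (((s / p : ℕ) : ℚ) * (((s / p : ℕ) : ℚ) - 1) / 2) * harm 2 (p - 1)))
            + (1 / (u + t) - (1 / u - t * (1 / u ^ 2) + t ^ 2 * (1 / u ^ 3))) := by
        rw [hdec, htdef]; ring
      rw [e]
      refine (padicNorm.nonarchimedean (p := p)).trans (max_le ih ?_)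
      exact padicNorm_div_add_sub_le₃ (by rw [padicNorm.one]) (padicNorm_residue_succ_eq_one hdvd) ht

end Summit.KontsevichZagierPeriods.Zeta5Search.SecondOrder

end
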